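import Summits.BirchSwinnertonDyer.BirchSwinnertonDyer.Theorems.SignedLowerHalvesSmallImageLowerHalfBothSignsRttD2SeqSemilocCoindModule
import HarnessLib

/-!
# Route `SignedLowerHalves`, crux L `SmallImageLowerHalfBothSigns` (stmt-BirchSwinnertonDyer-23599), line `rtt_w3` v32 — stub S3β″ (`stub_junctionPT_ns`), input N5-(iii)
# (unramified generator), component C5 (exact annihilator): `Ann_{Λ_𝒪}(δ_1 ⊗ (1 ⊗ ζ₀)) = (p^k, ω_n)` IN `Maps(Γ_K ⧸ U_n, X_k)`

WIDTH seat `bsd-line-slh-p3-w3` g27 under LEAD `cruxlead-stmt-BirchSwinnertonDyer-23599` g14 (cell `bsd-ssimc`); helper `--supports stmt-BirchSwinnertonDyer-23599`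
(plan `Lines/rtt_w3-DESIGN-N5iii-w3-g26.md` §2 C5). THEOREMS ONLY (no definition, no named fact, no instance, no `sorry`). HONEST FRAMING: finite-level commutative algebra — the reverse
inclusion `Ann(b₀) ⊆ (p^k, ω_n)` for the generator `b₀ = δ_1 ⊗ (1 ⊗ ζ₀)` of the cyclic `Λ_𝒪`-module `Maps(Γ_K ⧸ U_n, X_k)` (g27 `…RttD2SeqSemilocCoindModule`). No Weierstrass division is
needed: `X^{pⁿk} ∈ (p^k, ω_n)` ((1+X)^{pⁿ} = 1 + X^{pⁿ} + p·X·r`, Mathlib `exists_add_pow_prime_pow_eq`), so every `f ∈ Λ_𝒪` agrees with a POLYNOMIAL modulo an element of `(p^k, ω_n)`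
killing `b₀`; polynomial division by the monic `ω_n` leaves `Q` of degree `< pⁿ`; reading `Q(ψ) = Q̃(R_γ)` (`Q̃ = Q ∘ (X − 1)`) on `b₀` gives the function `[γ^i]⁻¹ ↦ q̃_i ⊗ ζ₀`
(`i < pⁿ`, distinct cosets as `κ γ` is a unit), so `Q(ψ) b₀ = 0` forces `p^k ∣ q̃_i` (`b ⊗ ζ₀ = 0 ↔ p^k ∣ b`), i.e. `C(p^k) ∣ Q`. Nothing about S3β″, crux L or BSD is proved;
all remain OPEN and are proved for NO curve.
References: [Lang1990] Ch. 5 §1 (Thm. 1.1); [Washington1997] §7.1, §13.2; [SerreLocalFields1979] VII §6; [NeukirchSchmidtWingberg2008] (5.3.5), (7.2.6).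
-/

set_option autoImplicit false
set_option linter.dupNamespace false -- D-0017: single-problem summit, the namespace repeats the problem name by design
noncomputable section

open scoped Classical PowerSeries
open NumberField IsDedekindDomain Field CategoryTheory Function

namespace Summit.BirchSwinnertonDyer.BirchSwinnertonDyer.Theorems.SmallImageRttD2Seq

open Literature.NumberTheory.EllipticCurves Literature.NumberTheory.GaloisRepresentations
  Literature.NumberTheory.GaloisRepresentations.DiscreteGaloisModule
  Literature.NumberTheory.ComplexMultiplication.EllipticUnits Literature.NumberTheory.ComplexMultiplication.EllipticUnits.JohnsonLeungKings2011
  Literature.Algebra.Module.LocallyNilpotent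
  Summit.BirchSwinnertonDyer.BirchSwinnertonDyer.Theorems.SmallImageRttD2J1

/-! ## §1. Pure algebra in `Λ_𝒪 = 𝒪⟦X⟧`: `X^{pⁿ k} ∈ (p^k, ω_n)` and truncation -/

section Algebra

variable {p : ℕ} [Fact p.Prime] (S : Set (PadicAlgCl p))

/-- **`X^{pⁿ} ∈ (C p, ω_n)`**: `(1+X)^{pⁿ} = 1 + X^{pⁿ} + p·X·r` (Mathlib `exists_add_pow_prime_pow_eq`). [cite: Washington1997, §7.1] -/
theorem X_pow_mem_span_C_omegaT (n : ℕ) :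
    (PowerSeries.X : IwasawaAlgebraO S) ^ p ^ n ∈ Ideal.span {PowerSeries.C ((p : ℕ) : padicCoeffIntegers S), omegaT S n} := by
  obtain ⟨r, hr⟩ := exists_add_pow_prime_pow_eq (Fact.out : p.Prime) (1 : IwasawaAlgebraO S) PowerSeries.X n
  rw [one_pow, mul_one] at hr
  have h : (PowerSeries.X : IwasawaAlgebraO S) ^ p ^ n = omegaT S n - PowerSeries.C ((p : ℕ) : padicCoeffIntegers S) * (PowerSeries.X * r) := by
    rw [omegaT, hr, map_natCast]; ring
  rw [h]
  exact Ideal.sub_mem _ (Ideal.subset_span (by simp)) (Ideal.mul_mem_right _ _ (Ideal.subset_span (by simp)))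

/-- `x ∈ (a, b) ⟹ x^k ∈ (a^k, b)` (binomial theorem). [folklore] -/
theorem pow_mem_span_pow_of_mem_span {R : Type*} [CommRing R] {a b x : R} (hx : x ∈ Ideal.span {a, b}) (k : ℕ) : x ^ k ∈ Ideal.span {a ^ k, b} := by
  obtain ⟨s, t, hst⟩ := Ideal.mem_span_pair.mp hx
  have hdvd : b ∣ x ^ k - (s * a) ^ k := by
    have h1 : b ∣ x - s * a := ⟨t, by rw [← hst]; ring⟩
    exact h1.trans (sub_dvd_pow_sub_pow _ _ k)
  obtain ⟨c, hc⟩ := hdvd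
  rw [show x ^ k = s ^ k * a ^ k + c * b by rw [← mul_pow]; linear_combination hc]
  exact Ideal.mem_span_pair.mpr ⟨s ^ k, c, by ring⟩

/-- **`X^{pⁿ k} ∈ (C(p^k), ω_n)`.** [cite: Washington1997, §7.1] [cite: Lang1990, Ch. 5 §1] -/
theorem X_pow_mem_span_C_pow_omegaT (n k : ℕ) :
    (PowerSeries.X : IwasawaAlgebraO S) ^ (p ^ n * k) ∈ Ideal.span {PowerSeries.C (((p : ℕ) : padicCoeffIntegers S) ^ k), omegaT S n} := by
  rw [pow_mul, map_pow]
  exact pow_mem_span_pow_of_mem_span (X_pow_mem_span_C_omegaT S n) k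

/-- A power series is its truncation plus a multiple of `X^M`. [folklore] -/
theorem exists_eq_trunc_add_X_pow_mul (M : ℕ) (f : IwasawaAlgebraO S) :
    ∃ t : IwasawaAlgebraO S, f = (PowerSeries.trunc M f : IwasawaAlgebraO S) + PowerSeries.X ^ M * t := by
  have h : (PowerSeries.X : IwasawaAlgebraO S) ^ M ∣ f - (PowerSeries.trunc M f : IwasawaAlgebraO S) := by
    rw [PowerSeries.X_pow_dvd_iff]
    intro m hm
    rw [map_sub, Polynomial.coeff_coe, PowerSeries.coeff_trunc, if_pos hm, sub_self]
  obtain ⟨t, ht⟩ := h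
  exact ⟨t, by rw [← ht, add_sub_cancel]⟩

/-- `ω_n` as a polynomial: `(X+1)^{pⁿ} − 1 ∈ 𝒪[X]` is monic of degree `pⁿ` and coerces to `omegaT`. [cite: Washington1997, §7.1] -/
theorem monic_omegaPoly (n : ℕ) : ((Polynomial.X + Polynomial.C 1 : Polynomial (padicCoeffIntegers S)) ^ p ^ n - 1).Monic := by
  refine Polynomial.Monic.sub_of_left ((Polynomial.monic_X_add_C 1).pow _) ?_
  rw [Polynomial.degree_one, Polynomial.degree_pow, Polynomial.degree_X_add_C, nsmul_one]
  exact_mod_cast pow_pos (Fact.out : p.Prime).pos n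

/-- The degree of `(X+1)^{pⁿ} − 1` is `pⁿ`. [folklore] -/
theorem natDegree_omegaPoly (n : ℕ) : ((Polynomial.X + Polynomial.C 1 : Polynomial (padicCoeffIntegers S)) ^ p ^ n - 1).natDegree = p ^ n := by
  rw [Polynomial.natDegree_sub_eq_left_of_natDegree_lt] <;>
    rw [Polynomial.natDegree_pow, Polynomial.natDegree_X_add_C, mul_one]
  rw [Polynomial.natDegree_one]
  exact pow_pos (Fact.out : p.Prime).pos n

/-- The coercion of `(X+1)^{pⁿ} − 1` to `Λ_𝒪` is `omegaT`. [folklore] -/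
theorem coe_omegaPoly (n : ℕ) :
    (((Polynomial.X + Polynomial.C 1 : Polynomial (padicCoeffIntegers S)) ^ p ^ n - 1 : Polynomial (padicCoeffIntegers S)) : IwasawaAlgebraO S) = omegaT S n := by
  rw [omegaT, Polynomial.coe_sub, Polynomial.coe_pow, Polynomial.coe_add, Polynomial.coe_X, Polynomial.coe_C, Polynomial.coe_one, map_one, add_comm]

end Algebra

/-! ## §2. The exact annihilator of `b₀ = δ_1 ⊗ (1 ⊗ ζ₀)` -/

section Ann

variable {K : Type} [Field K] {p : ℕ} [Fact p.Prime] (S : Set (PadicAlgCl p)) (κ : ZpExtension K p) (γ : absoluteGaloisGroup K)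
  (θ' : absoluteGaloisGroup K →ₜ* (padicCoeffIntegers S)ˣ) (P : Set (HeightOneSpectrum (𝓞 K)))

/-- **Distinct small powers of `γ` give distinct cosets**: `[γ^i] = [γ^m]` in `Γ_K ⧸ U_n` with `i, m < pⁿ` forces `i = m` (`κ γ` a unit of `ℤ_p`). [cite: Washington1997, §13.1] -/
theorem eq_of_mk_pow_eq (n : ℕ) {a : ℤ_[p]ˣ} (hγ : (κ γ).toAdd = a) {i m : ℕ} (hi : i < p ^ n) (hm : m < p ^ n)
    (h : ((γ ^ i : absoluteGaloisGroup K) : absoluteGaloisGroup K ⧸ κ.layerSubgroup n) = ((γ ^ m : absoluteGaloisGroup K) : absoluteGaloisGroup K ⧸ κ.layerSubgroup n)) :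
    i = m := by
  rw [QuotientGroup.eq] at h
  rw [ZpExtension.mem_layerSubgroup, map_mul, map_inv, map_pow, map_pow, toAdd_mul, toAdd_inv, toAdd_pow, toAdd_pow, hγ] at h
  -- `p^n ∣ (m - i) • a`, `a` a unit
  have h2 : (p : ℤ_[p]) ^ n ∣ ((m : ℤ_[p]) - (i : ℤ_[p])) := by
    have h1 : (p : ℤ_[p]) ^ n ∣ (((m : ℤ_[p]) - (i : ℤ_[p])) * a) := by
      rw [nsmul_eq_mul, nsmul_eq_mul] at h
      convert h using 1
      ring
    exact (IsUnit.dvd_mul_right a.isUnit).mp h1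
  have h3 : ((m : ℤ) : ZMod (p ^ n)) = ((i : ℤ) : ZMod (p ^ n)) := by
    have h4 : PadicInt.toZModPow n ((m : ℤ_[p]) - (i : ℤ_[p])) = 0 := by
      rw [← RingHom.mem_ker, PadicInt.ker_toZModPow]
      exact Ideal.mem_span_singleton.mpr h2
    rw [map_sub, map_natCast, map_natCast, sub_eq_zero] at h4
    exact_mod_cast h4
  rw [ZMod.intCast_eq_intCast_iff, Int.ModEq] at h3
  have h5 : (m : ℤ) % (p ^ n : ℕ) = m := Int.emod_eq_of_lt (by positivity) (by exact_mod_cast hm)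
  have h6 : (i : ℤ) % (p ^ n : ℕ) = i := Int.emod_eq_of_lt (by positivity) (by exact_mod_cast hi)
  rw [h5, h6] at h3
  exact_mod_cast h3.symm

set_option maxHeartbeats 1600000 in
/-- `(ψ + 1)^i = R_{γ^i}` on `Maps(Γ_K ⧸ U_n, X_k)`. [folklore] -/
theorem coindPsi_add_one_pow_apply (n k i : ℕ) (f : coindFin.{0, 0} (coeffRepK S θ' P k).toTopRep (κ.layerSubgroup n)) :
    (letI := coindModuleO S κ θ' P n k; ((coindPsi S κ γ θ' P n k + 1) ^ i) f) = coindR S κ θ' P n k (γ ^ i) f := by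
  letI := coindModuleO S κ θ' P n k
  rw [← coindR_pow_apply]
  induction i generalizing f with
  | zero => rfl
  | succ i ih =>
    rw [pow_succ, Module.End.mul_apply, pow_succ, AddMonoid.End.coe_mul, Function.comp_apply]
    rw [LinearMap.add_apply]
    rw [coindPsi_apply]
    rw [Module.End.one_apply, sub_add_cancel]
    rw [ih]
    rfl

/-- Evaluation of a finite sum of functions of `Maps(Γ_K ⧸ U_n, X_k)` at a coset. [folklore] -/
theorem coind_finset_sum_apply {ι : Type*} (s : Finset ι) (n k : ℕ) (g : ι → coindFin.{0, 0} (coeffRepK S θ' P k).toTopRep (κ.layerSubgroup n))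
    (y : absoluteGaloisGroup K ⧸ κ.layerSubgroup n) : (∑ i ∈ s, g i) y = ∑ i ∈ s, g i y := by
  induction s using Finset.cons_induction with
  | empty => rfl
  | cons a s ha ih => rw [Finset.sum_cons, Finset.sum_cons, ← ih]; rfl

set_option maxHeartbeats 1600000 in
/-- ★★ **THE EXACT ANNIHILATOR OF THE GENERATOR: `r • (δ_1 ⊗ (1 ⊗ ζ₀)) = 0 ↔ r ∈ (C(p^k), ω_n)`** in the `Λ_𝒪`-module `Maps(Γ_K ⧸ U_n, X_k)`, for `κ γ` a unit, `ζ₀` a generator of `μ_{p^k}` of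
exact order `p^k` (`e ζ₀ = 1`), `θ′` trivial on `N_P` and `N_P` fixing `μ_{p^k}`. Hence `Maps(Γ_K ⧸ U_n, X_k) ≅ Λ_𝒪 ⧸ (p^k, ω_n)` (with `exists_smul_single_one_eq`). [cite: Lang1990, Ch. 5 §1 Thm. 1.1]
[cite: Washington1997, §13.2] [cite: SerreLocalFields1979, VII §6] -/
theorem smul_single_one_eq_zero_iff (n k : ℕ) {a : ℤ_[p]ˣ} (hγ : (κ γ).toAdd = a) (hθN : ∀ g ∈ ramificationSubgroup K P, θ' g = 1)
    (hμN : ∀ g ∈ ramificationSubgroup K P, ∀ ζ : MuCarrier K (p ^ k), mu K (p ^ k) g ζ = ζ)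
    {e : MuCarrier K (p ^ k) ≃+ ZMod (p ^ k)} {ζ₀ : MuCarrier K (p ^ k)} (he : e ζ₀ = 1) (hord : ∀ m : ℤ, m • ζ₀ = 0 ↔ ((p ^ k : ℕ) : ℤ) ∣ m)
    (r : IwasawaAlgebraO S) :
    (letI := coindModuleΛ S κ γ θ' P n k;
      r • coindSingle S κ θ' P n k 1 ⟨OMuCarrier.tmul 1 ζ₀, mem_invariants_muTwistO_of_forall S θ' P k hθN hμN _⟩ = 0) ↔
      r ∈ Ideal.span {PowerSeries.C (((p : ℕ) : padicCoeffIntegers S) ^ k), omegaT S n} := by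
  letI := coindModuleO S κ θ' P n k
  letI := coindModuleΛ S κ γ θ' P n k
  haveI := isScalarTower_of_C_smul (coindModuleΛ_spec S κ γ θ' P n k).1
  set J : Ideal (IwasawaAlgebraO S) := Ideal.span {PowerSeries.C (((p : ℕ) : padicCoeffIntegers S) ^ k), omegaT S n} with hJ
  set b₀ : coindFin.{0, 0} (coeffRepK S θ' P k).toTopRep (κ.layerSubgroup n) :=
    coindSingle S κ θ' P n k 1 ⟨OMuCarrier.tmul 1 ζ₀, mem_invariants_muTwistO_of_forall S θ' P k hθN hμN _⟩ with hb₀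
  -- `J` kills `b₀`
  have hJkill : ∀ x ∈ J, x • b₀ = 0 := by
    intro x hx
    obtain ⟨s, t, rfl⟩ := Ideal.mem_span_pair.mp hx
    rw [add_smul, mul_smul, mul_smul, C_pow_smul, omegaT_smul, smul_zero, smul_zero, add_zero]
  constructor
  swap
  · exact hJkill r
  intro hr
  -- reduce to a polynomial: `r = trunc_M r + X^M t`, `X^M ∈ J`
  set M : ℕ := p ^ n * k with hM
  obtain ⟨t, ht⟩ := exists_eq_trunc_add_X_pow_mul S M r
  have hXM : (PowerSeries.X : IwasawaAlgebraO S) ^ M * t ∈ J := Ideal.mul_mem_right _ _ (X_pow_mem_span_C_pow_omegaT S n k)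
  set Q : Polynomial (padicCoeffIntegers S) := PowerSeries.trunc M r with hQ
  have hQb : (Q : IwasawaAlgebraO S) • b₀ = 0 := by
    have h := hr
    rw [ht, add_smul, hJkill _ hXM, add_zero] at h
    exact h
  suffices hQJ : (Q : IwasawaAlgebraO S) ∈ J by
    rw [ht]; exact J.add_mem hQJ hXM
  -- polynomial division by the monic `ω`
  set ω : Polynomial (padicCoeffIntegers S) := (Polynomial.X + Polynomial.C 1) ^ p ^ n - 1 with hω
  have hωJ : (ω : IwasawaAlgebraO S) ∈ J := by rw [coe_omegaPoly]; exact Ideal.subset_span (by simp)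
  set Q₁ : Polynomial (padicCoeffIntegers S) := Q %ₘ ω with hQ₁
  have hdiv : Q₁ + ω * (Q /ₘ ω) = Q := Polynomial.modByMonic_add_div Q ω
  have hQ₁deg : Q₁.natDegree < p ^ n := by
    rw [← natDegree_omegaPoly S n]
    refine Polynomial.natDegree_modByMonic_lt Q (monic_omegaPoly S n) ?_
    intro h1
    have h2 := congrArg Polynomial.natDegree h1
    rw [natDegree_omegaPoly, Polynomial.natDegree_one] at h2
    exact absurd h2 (pow_ne_zero _ (Fact.out : p.Prime).ne_zero)
  have hQ₁b : (Q₁ : IwasawaAlgebraO S) • b₀ = 0 := by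
    have h : (Q : IwasawaAlgebraO S) = Q₁ + ω * (Q /ₘ ω : Polynomial (padicCoeffIntegers S)) := by
      rw [← Polynomial.coe_mul, ← Polynomial.coe_add, hdiv]
    rw [h, add_smul, mul_comm, mul_smul, hJkill _ hωJ, smul_zero, add_zero] at hQb
    exact hQb
  -- read `Q₁(ψ) b₀` as `Q₂(R_γ) b₀`, `Q₂ = Q₁ ∘ (X − 1)`
  obtain ⟨hC, hX⟩ := coindModuleΛ_spec S κ γ θ' P n k
  set Q₂ : Polynomial (padicCoeffIntegers S) := Q₁.comp (Polynomial.X - Polynomial.C 1) with hQ₂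
  have hQ₂deg : Q₂.natDegree < p ^ n := by
    rw [hQ₂, Polynomial.natDegree_comp, Polynomial.natDegree_X_sub_C, mul_one]; exact hQ₁deg
  have hQ₁₂ : Q₁ = Q₂.comp (Polynomial.X + Polynomial.C 1) := by
    rw [hQ₂, Polynomial.comp_assoc, Polynomial.sub_comp, Polynomial.X_comp, Polynomial.C_comp, add_sub_cancel_right, Polynomial.comp_X]
  have hsum : (Q₁ : IwasawaAlgebraO S) • b₀ =
      ∑ i ∈ Finset.range (p ^ n), coindSingle S κ θ' P n k (((γ ^ i : absoluteGaloisGroup K) : absoluteGaloisGroup K ⧸ κ.layerSubgroup n)⁻¹)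
        (coeffMapO S P θ' (oMuScalar S (p ^ k) (Q₂.coeff i)) (oMuScalar_muTwistO S θ' k (Q₂.coeff i))
          ⟨OMuCarrier.tmul 1 ζ₀, mem_invariants_muTwistO_of_forall S θ' P k hθN hμN _⟩) := by
    rw [coe_polynomial_smul_eq_aeval_apply hC hX Q₁ b₀, hQ₁₂, Polynomial.aeval_comp, map_add, Polynomial.aeval_X, Polynomial.aeval_C, map_one,
      Polynomial.aeval_eq_sum_range' hQ₂deg, LinearMap.sum_apply]
    refine Finset.sum_congr rfl fun i _ ↦ ?_
    rw [LinearMap.smul_apply, coindPsi_add_one_pow_apply, hb₀, coindR_single, one_mul, coindModuleO_smul, coindScalar_single]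
  -- evaluate at the coset `[γ^m]⁻¹`, `m < pⁿ`: the coefficient `q̃_m ⊗ ζ₀` vanishes, so `p^k ∣ q̃_m`
  have hcoeff : ∀ m : ℕ, ((p : padicCoeffIntegers S) ^ k) ∣ Q₂.coeff m := by
    intro m
    by_cases hm : m < p ^ n
    · have hval := congrArg (fun g : coindFin.{0, 0} (coeffRepK S θ' P k).toTopRep (κ.layerSubgroup n) ↦
        ((g (((γ ^ m : absoluteGaloisGroup K) : absoluteGaloisGroup K ⧸ κ.layerSubgroup n)⁻¹) : (coeffRepK S θ' P k).toTopRep) : OMuCarrier K S (p ^ k))) hQ₁b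
      simp only [hsum] at hval
      rw [coind_finset_sum_apply, Finset.sum_eq_single m] at hval
      · rw [coindSingle_apply_self] at hval
        change oMuScalar S (p ^ k) (Q₂.coeff m) (OMuCarrier.tmul 1 ζ₀) = ((0 : (coeffRepK S θ' P k).toTopRep) : OMuCarrier K S (p ^ k)) at hval
        rw [oMuScalar_tmul, mul_one] at hval
        exact (tmul_eq_zero_iff_dvd (K := K) S k he hord (Q₂.coeff m)).1 hval
      · intro i hi him
        rw [coindSingle_apply_of_ne]
        intro h
        exact him (eq_of_mk_pow_eq κ γ n hγ (Finset.mem_range.mp hi) hm (inv_injective h).symm)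
      · intro h
        exact absurd (Finset.mem_range.mpr hm) h
    · rw [Polynomial.coeff_eq_zero_of_natDegree_lt (lt_of_lt_of_le hQ₂deg (not_lt.mp hm))]
      exact dvd_zero _
  obtain ⟨Q₃, hQ₃⟩ := (Polynomial.C_dvd_iff_dvd_coeff _ Q₂).2 hcoeff
  have hQ₁J : (Q₁ : IwasawaAlgebraO S) ∈ J := by
    rw [hQ₁₂, hQ₃, Polynomial.mul_comp, Polynomial.C_comp, Polynomial.coe_mul, Polynomial.coe_C]
    exact Ideal.mul_mem_right _ _ (Ideal.subset_span (by simp))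
  rw [← hdiv, Polynomial.coe_add, Polynomial.coe_mul]
  exact J.add_mem hQ₁J (Ideal.mul_mem_right _ _ hωJ)

end Ann

end Summit.BirchSwinnertonDyer.BirchSwinnertonDyer.Theorems.SmallImageRttD2Seq

end
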